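import Summits.QuantumFields.BalabanUV.T4Continuum.Spine.NE3.PairLandauB8Avg
import Summits.QuantumFields.BalabanUV.T4Continuum.Support.NE3DecomposedRepOfLinearNormalPart
import Summits.QuantumFields.BalabanUV.T4Continuum.Support.NE3ProductPathChartSlice
import HarnessLib

/-!
# T⁴ programme, node NE3 — REPAIR R24 (γ4), file 1∕2: `DecomposedRepT` ON B8's TANGENT SLICE `slicB8` FROM A REPRESENTATIVE AND A LINEAR NORMAL PART —
# the T-free copy of route Π's file 2 `NE3DecomposedRepOfLinearNormalPart.decomposedRep_of_linearNormalPart`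

Cell `pub-balaban-gaps` (YM blitz, track G2, seat `ne3`, unit `pub-balaban-gaps-ne3`; writer prover-pub-balaban-gaps-ne3-g3-0, 2026-08-23), census
`run/shared/lean/pub/pub-balaban-gaps/ne/NE3.md` §4 R24 (γ4).  The owner's file 2 builds route Π's `DecomposedRep` (on `T_♮(W)`) from an R-adapted residual slice representative
and the pre-sizes of a linear normal part; its proof uses the slice ONLY through the skewness and periodicity of its members.  THIS FILE is that proof VERBATIM with the slice
hypothesis `Nn − X₀ ∈ slicB8 L N (j+1) W` (`Spine/NE3/PairLandauB8Avg.slicB8`, p341788 ✓) and the conclusion `NE3ProductPathChartSlice.DecomposedRepT … (slicB8 …) …`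
(p341346 ✓); file 2∕2 `Spine/NE3/SupplierB8` assembles the supplier on B8's surface from it.

CONTENT ([folklore]; 0 sorry; no `def`): **`decomposedRepT_slicB8_of_linearNormalPart`**.

HONEST FRAMING.  Bookkeeping over landed kernel theorems; every letter is a HYPOTHESIS; nothing about Bałaban's minimisers is proved; the chart supplier's remaining inputs,
(P♮), (RES♯)'s projection bound, the covariant root and **NE3 are NOT proved**; spine PROVED 0∕9; finite T⁴ rung (B)+1 — NOT infinite volume, NOT mass gap, NOT `BetaPertH`,
NOT Clay.  PLACEMENT: `Summits/QuantumFields/BalabanUV/T4Continuum/Spine/NE3/`; imports accepted modules only; moves nothing.  HONEST DEPENDENCY: continuum YM on T⁴ ⇐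
BetaPertH ∧ nine spine estimates (0/9 proved); BetaPertH ⇐ (D1) ∧ (D4) ∧ CAP+tail; G-an2-4 gates asym, D1 and NE2/3/4.
-/

set_option autoImplicit false

open scoped BigOperators Matrix.Norms.L2Operator
open NormedSpace Finset

namespace Summit.QuantumFields.BalabanUV.T4Continuum.NE3.DecomposedRepTSlicB8

open Set
open Literature.MathematicalPhysics.QuantumFieldTheory.Balaban1983to89
open B7Prop1Explicit B7Prop2Explicit B7Prop3Flat MatrixLog
open T4AveragingDeficitWall (IsSkewDir IsUnitaryCfg SmallField vary curl curlSq dirSq dirL1 fhol Ad)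
open T4AveragingDeficitWallBoundary (IsPeriodicCfg periodBox)
open AveragingDeficitPeriodicCounting (IsPeriodicDir)
open AveragingDeficitChartCalculus (cavg)
open AveragingDeficitMultiLevelPrep (cavgIter LevelSmall)
open BlockAveragePushDirGauge (gaugeDir)
open MinimalActionLevels (perWin)
open MinimalActionSandwich (admissible)
open NE3EnergyShapes (IsUnitarySite IsPeriodicSite)
open NE3CovariantCalculus (hsR hsR_sub_left)
open NE3TangentCovariantTower (QbarIter)
open NE3EnergyWeightedShapes (energyNormW energyNormW_nonneg)
open NE3ProductPath (pathΓ prodM prodM_zero skewHalf skewHalf_eq_self)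
open NE3ProductPathBounds (energyNormW_le_of_pointwise energyNormW_add_le sum_norm_curl_le_dirL1 curl_add_dir)
open NE3ProductPathChartSlice (DecomposedRepT)
open AveragingDeficitDerivCore (dirL1_nonneg)
open NE3EnergyHessCont (perWin_eq_plaqsOf)
open NE3CurlPairedResidualSpread (dirL1_le_of_pointwise)
open NE3ResidualSliceRep (normalPart normalPart_apply norm_normalPart_sub_le norm_normalPart_le normalPart_skew exp_normalPart_mul_exp_neg)
open NE3DecomposedRepOfLinearNormalPart (sum_norm_curl_normalPart_le)
open NE3.PairLandauB8 (avgKernelGauges IsLandauB8 LandauRepB8)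
open NE3.PairLandauB8Avg (LandauRepB8Avg slicB8 mem_slicB8_iff skew_of_mem_slicB8 periodic_of_mem_slicB8)

noncomputable section

variable {d : ℕ} {n : Type*} [Fintype n] [DecidableEq n]

/-! ## `DecomposedRepT` on `slicB8` from a representative and a linear normal part — the T-free copy of route Π's file 2 -/

/-- **`DecomposedRepT` ON `slicB8` FROM A REPRESENTATIVE AND A LINEAR NORMAL PART** (level `j+1`, `L, N ≥ 1`; background `W = cavg L U_B` unitary, admissible for run A at
datum `V`): VERBATIM `NE3DecomposedRepOfLinearNormalPart.decomposedRep_of_linearNormalPart` with the slice hypothesis `Nn − X₀ ∈ slicB8 L N (j+1) W` in place of the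
`T_♮`-adapted residual shape (the proof uses the slice only through the skewness and periodicity of its members). [folklore] -/
theorem decomposedRepT_slicB8_of_linearNormalPart [Nonempty n] {𝒞 : ℕ → _root_.Set (Site d → Fin d → (Matrix n n ℂ)ˣ)} {L N : ℕ}
    (hL : 1 ≤ L) (hN : 1 ≤ N) (j : ℕ) {V UA UB : Site d → Fin d → (Matrix n n ℂ)ˣ} (hWu : IsUnitaryCfg (cavg L UB))
    (admW : cavg L UB ∈ admissible 𝒞 L (j + 1) V)
    {u : Site d → (Matrix n n ℂ)ˣ} {X₀ Nn : Site d → Fin d → Matrix n n ℂ} {α₀ : ℝ}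
    (hgauge : IsUnitarySite u ∧ IsPeriodicSite u ((N * L ^ (j + 1) : ℕ) : ℤ)) (hrep0 : gaugeAct u UA = vary (cavg L UB) X₀ 1)
    (hX₀s : IsSkewDir X₀) (hX₀P : IsPeriodicDir X₀ ((N * L ^ (j + 1) : ℕ) : ℤ)) (hα₀0 : 0 ≤ α₀)
    (hX₀sup : ∀ (x : Site d) (μ : Fin d), ‖X₀ x μ‖ ≤ α₀)
    (htan : (fun y μ => Nn y μ - X₀ y μ) ∈ slicB8 (d := d) (n := n) L N (j + 1) (cavg L UB)) (hα₀ : α₀ ≤ 1 / 100)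
    {αN : ℝ} (hNP : IsPeriodicDir Nn ((N * L ^ (j + 1) : ℕ) : ℤ))
    (hαN0 : 0 ≤ αN) (hNsup : ∀ y μ, ‖Nn y μ‖ ≤ αN) (hαN : αN ≤ 1 / 2700)
    (hJ1 : (α₀ + 43 * αN) * (L : ℝ) ^ (j + 1) ≤ 1)
    {ν₀ k₁ k₂ a : ℝ} (ha : 0 ≤ a)
    (hnw : energyNormW L (j + 1) (cavg L UB) Nn (periodBox (N * L ^ (j + 1)))
      ≤ ν₀ * energyNormW L (j + 1) (cavg L UB) (fun y μ => Nn y μ - X₀ y μ) (periodBox (N * L ^ (j + 1))))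
    (hcurl : a * ∑ p ∈ perWin d (N * L ^ (j + 1)), ‖curl (cavg L UB) Nn p‖
      ≤ k₁ * energyNormW L (j + 1) (cavg L UB) (fun y μ => Nn y μ - X₀ y μ) (periodBox (N * L ^ (j + 1))) ^ 2)
    (hl1 : a * ((α₀ + αN) * dirL1 Nn (periodBox (N * L ^ (j + 1))))
      ≤ k₂ * energyNormW L (j + 1) (cavg L UB) (fun y μ => Nn y μ - X₀ y μ) (periodBox (N * L ^ (j + 1))) ^ 2)
    (hsmall : ∀ t ∈ Icc (0:ℝ) 1, ∀ p ∈ perWin d (N * L ^ (j + 1)),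
      ‖((fhol (vary (cavg L UB) (pathΓ (fun y μ => Nn y μ - X₀ y μ) (normalPart X₀ fun y μ => Nn y μ - X₀ y μ) t) 1) p
        : (Matrix n n ℂ)ˣ) : Matrix n n ℂ) - 1‖ ≤ a) :
    DecomposedRepT 𝒞 L N (j + 1) V UA UB u (fun y μ => Nn y μ - X₀ y μ) (normalPart X₀ fun y μ => Nn y μ - X₀ y μ)
      (slicB8 (d := d) (n := n) L N (j + 1) (cavg L UB))
      (α₀ + αN) ((1 + 2048 * (α₀ + αN)) * αN) ((1 + 2048 * Real.sqrt (16 * d + 1)) * ν₀) (k₁ + 8192 * d * k₂) (1806 * k₂) a := by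
  -- written without abbreviations (W = cavg L UB, X = Nn − X₀, N = normalPart X₀ X, F = periodBox (N·L^{j+1}), s = α₀ + αN)
  have hP : 1 ≤ N * L ^ (j + 1) := Nat.mul_pos (by omega) (Nat.pow_pos (by omega))
  have hXs : IsSkewDir (fun y μ => Nn y μ - X₀ y μ) := skew_of_mem_slicB8 htan
  have hXP : IsPeriodicDir (fun y μ => Nn y μ - X₀ y μ) ((N * L ^ (j + 1) : ℕ) : ℤ) := periodic_of_mem_slicB8 htan
  have hs0 : 0 ≤ α₀ + αN := by positivity
  have h32 : α₀ + αN < 1 / 32 := by linarith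
  have hαN32 : αN < 1 / 32 := by linarith
  have hXsup : ∀ y μ, ‖Nn y μ - X₀ y μ‖ ≤ α₀ + αN := fun y μ =>
    (norm_sub_le _ _).trans (by rw [add_comm]; exact add_le_add (hX₀sup y μ) (hNsup y μ))
  have hX32 : ∀ y μ, ‖Nn y μ - X₀ y μ‖ ≤ 1 / 32 := fun y μ => (hXsup y μ).trans h32.le
  have hX₀32 : ∀ y μ, ‖X₀ y μ‖ ≤ 1 / 32 := fun y μ => (hX₀sup y μ).trans (by linarith)
  -- file 1's pointwise facts about `N := normalPart X₀ X`
  have hNgs : IsSkewDir (normalPart X₀ fun y μ => Nn y μ - X₀ y μ) := normalPart_skew hX₀s hXs hX₀32 hX32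
  have hNgP : IsPeriodicDir (normalPart X₀ fun y μ => Nn y μ - X₀ y μ) ((N * L ^ (j + 1) : ℕ) : ℤ) := fun y κ μ => by
    simp only [normalPart, hX₀P y κ μ, hNP y κ μ]
  have hNgsup : ∀ y μ, ‖normalPart X₀ (fun y μ => Nn y μ - X₀ y μ) y μ‖ ≤ (1 + 2048 * (α₀ + αN)) * αN := fun y μ =>
    norm_normalPart_le (hXsup y μ) h32 (hNsup y μ) hαN32
  have hNgsub : ∀ y μ, ‖normalPart X₀ (fun y μ => Nn y μ - X₀ y μ) y μ - Nn y μ‖ ≤ 2048 * (α₀ + αN) * ‖Nn y μ‖ := by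
    intro y μ
    have hb := norm_normalPart_sub_le (X₀ := X₀) (Nn := Nn) (y := y) (μ := μ) ((hXsup y μ).trans_lt h32)
      ((hNsup y μ).trans_lt hαN32)
    have h1 : 0 ≤ ‖Nn y μ‖ := norm_nonneg _
    calc ‖normalPart X₀ (fun y μ => Nn y μ - X₀ y μ) y μ - Nn y μ‖ ≤ 2048 * ‖Nn y μ - X₀ y μ‖ * ‖Nn y μ‖ := hb
      _ ≤ 2048 * (α₀ + αN) * ‖Nn y μ‖ := by nlinarith [hXsup y μ]
  have hrep : ∀ y μ, ((gaugeAct u UA y μ : (Matrix n n ℂ)ˣ) : Matrix n n ℂ)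
      = (cavg L UB y μ : Matrix n n ℂ) * (exp (normalPart X₀ (fun y μ => Nn y μ - X₀ y μ) y μ) * exp (-(Nn y μ - X₀ y μ))) := by
    intro y μ
    have key := exp_normalPart_mul_exp_neg (X₀ := X₀) (X := fun y μ => Nn y μ - X₀ y μ) (y := y) (μ := μ) (hX₀32 y μ) (hX32 y μ)
    rw [hrep0]
    rw [key]
    simp [vary]
  -- numeric helpers
  have h42 : 1 + 2048 * (α₀ + αN) ≤ 42 := by linarith
  have hb : (1 + 2048 * (α₀ + αN)) * αN ≤ 42 * αN := mul_le_mul_of_nonneg_right h42 hαN0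
  have hc0 : 0 ≤ 2048 * (α₀ + αN) := by positivity
  have hsL : (α₀ + αN) * (L : ℝ) ^ (j + 1) ≤ 1 := by
    have h1 : (α₀ + αN) ≤ α₀ + 43 * αN := by linarith
    exact (mul_le_mul_of_nonneg_right h1 (by positivity : (0:ℝ) ≤ (L : ℝ) ^ (j + 1))).trans hJ1
  -- SIZE 1: the weighted norm of `N`
  have hNX := energyNormW_nonneg L (j + 1) (cavg L UB) (fun y μ => Nn y μ - X₀ y μ) (periodBox (d := d) (N * L ^ (j + 1)))
  have hDP : IsPeriodicDir (fun y μ => (normalPart X₀ fun y μ => Nn y μ - X₀ y μ) y μ - Nn y μ) ((N * L ^ (j + 1) : ℕ) : ℤ) :=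
    fun y κ μ => by
      show (normalPart X₀ fun y μ => Nn y μ - X₀ y μ) (y + ((N * L ^ (j + 1) : ℕ) : ℤ) • e κ) μ - Nn (y + ((N * L ^ (j + 1) : ℕ) : ℤ) • e κ) μ
        = (normalPart X₀ fun y μ => Nn y μ - X₀ y μ) y μ - Nn y μ
      rw [hNgP y κ μ, hNP y κ μ]
  have hdiff : energyNormW L (j + 1) (cavg L UB) (fun y μ => (normalPart X₀ fun y μ => Nn y μ - X₀ y μ) y μ - Nn y μ)
        (periodBox (d := d) (N * L ^ (j + 1)))
      ≤ Real.sqrt (16 * d + 1) * (2048 * (α₀ + αN)) * (L : ℝ) ^ (j + 1)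
        * energyNormW L (j + 1) (cavg L UB) Nn (periodBox (d := d) (N * L ^ (j + 1))) :=
    energyNormW_le_of_pointwise hWu hL (j + 1) hP hDP hc0 fun y μ => hNgsub y μ
  have hNg_eq : (normalPart X₀ fun y μ => Nn y μ - X₀ y μ)
      = (fun y μ => (normalPart X₀ fun y μ => Nn y μ - X₀ y μ) y μ - Nn y μ) + Nn := by
    funext y μ; simp only [Pi.add_apply, sub_add_cancel]
  have hnwN : energyNormW L (j + 1) (cavg L UB) (normalPart X₀ fun y μ => Nn y μ - X₀ y μ) (periodBox (d := d) (N * L ^ (j + 1)))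
      ≤ (1 + 2048 * Real.sqrt (16 * d + 1)) * ν₀
        * energyNormW L (j + 1) (cavg L UB) (fun y μ => Nn y μ - X₀ y μ) (periodBox (d := d) (N * L ^ (j + 1))) := by
    have h1 : energyNormW L (j + 1) (cavg L UB) (normalPart X₀ fun y μ => Nn y μ - X₀ y μ) (periodBox (d := d) (N * L ^ (j + 1)))
        ≤ energyNormW L (j + 1) (cavg L UB) (fun y μ => (normalPart X₀ fun y μ => Nn y μ - X₀ y μ) y μ - Nn y μ)
            (periodBox (d := d) (N * L ^ (j + 1)))
          + energyNormW L (j + 1) (cavg L UB) Nn (periodBox (d := d) (N * L ^ (j + 1))) := by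
      conv_lhs => rw [hNg_eq]
      exact energyNormW_add_le L (j + 1) (cavg L UB) _ Nn (periodBox (d := d) (N * L ^ (j + 1)))
    have hNn0 := energyNormW_nonneg L (j + 1) (cavg L UB) Nn (periodBox (d := d) (N * L ^ (j + 1)))
    have h2 : Real.sqrt (16 * d + 1) * (2048 * (α₀ + αN)) * (L : ℝ) ^ (j + 1) ≤ 2048 * Real.sqrt (16 * d + 1) := by
      nlinarith [mul_le_mul_of_nonneg_left hsL (by positivity : (0:ℝ) ≤ 2048 * Real.sqrt (16 * d + 1))]
    have h3 : energyNormW L (j + 1) (cavg L UB) (fun y μ => (normalPart X₀ fun y μ => Nn y μ - X₀ y μ) y μ - Nn y μ)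
          (periodBox (d := d) (N * L ^ (j + 1)))
        ≤ 2048 * Real.sqrt (16 * d + 1) * energyNormW L (j + 1) (cavg L UB) Nn (periodBox (d := d) (N * L ^ (j + 1))) :=
      hdiff.trans (mul_le_mul_of_nonneg_right h2 hNn0)
    have h4 : energyNormW L (j + 1) (cavg L UB) Nn (periodBox (d := d) (N * L ^ (j + 1)))
        ≤ ν₀ * energyNormW L (j + 1) (cavg L UB) (fun y μ => Nn y μ - X₀ y μ) (periodBox (d := d) (N * L ^ (j + 1))) := hnw
    calc energyNormW L (j + 1) (cavg L UB) (normalPart X₀ fun y μ => Nn y μ - X₀ y μ) (periodBox (d := d) (N * L ^ (j + 1)))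
        ≤ (1 + 2048 * Real.sqrt (16 * d + 1)) * energyNormW L (j + 1) (cavg L UB) Nn (periodBox (d := d) (N * L ^ (j + 1))) := by
          linarith
      _ ≤ (1 + 2048 * Real.sqrt (16 * d + 1))
            * (ν₀ * energyNormW L (j + 1) (cavg L UB) (fun y μ => Nn y μ - X₀ y μ) (periodBox (d := d) (N * L ^ (j + 1)))) :=
          mul_le_mul_of_nonneg_left h4 (by positivity)
      _ = _ := by ring
  -- SIZE 2: the ℓ¹-curl of `N`
  have hdl0 : 0 ≤ dirL1 Nn (periodBox (d := d) (N * L ^ (j + 1))) := dirL1_nonneg _ _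
  have hcurlN : a * ∑ p ∈ perWin d (N * L ^ (j + 1)), ‖curl (cavg L UB) (normalPart X₀ fun y μ => Nn y μ - X₀ y μ) p‖
      ≤ (k₁ + 8192 * d * k₂) * energyNormW L (j + 1) (cavg L UB) (fun y μ => Nn y μ - X₀ y μ) (periodBox (d := d) (N * L ^ (j + 1))) ^ 2 := by
    have h1 := sum_norm_curl_normalPart_le hWu hP hNP hNgP (c := 2048 * (α₀ + αN)) fun y μ => hNgsub y μ
    have h2 := mul_le_mul_of_nonneg_left h1 ha
    -- `a·4d·2048·s·dirL1 Nn = 8192·d·(a·(s·dirL1 Nn)) ≤ 8192·d·k₂·‖X‖_w²`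
    have h3 : a * (4 * d * (2048 * (α₀ + αN) * dirL1 Nn (periodBox (d := d) (N * L ^ (j + 1)))))
        = 8192 * d * (a * ((α₀ + αN) * dirL1 Nn (periodBox (d := d) (N * L ^ (j + 1))))) := by ring
    have h4 : 8192 * (d : ℝ) * (a * ((α₀ + αN) * dirL1 Nn (periodBox (d := d) (N * L ^ (j + 1)))))
        ≤ 8192 * d * (k₂ * energyNormW L (j + 1) (cavg L UB) (fun y μ => Nn y μ - X₀ y μ) (periodBox (d := d) (N * L ^ (j + 1))) ^ 2) :=
      mul_le_mul_of_nonneg_left hl1 (by positivity)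
    rw [mul_add, h3] at h2
    linarith
  -- SIZE 3: the ℓ¹ size of `N`
  have hl1N : a * (((α₀ + αN) + (1 + 2048 * (α₀ + αN)) * αN)
        * dirL1 (normalPart X₀ fun y μ => Nn y μ - X₀ y μ) (periodBox (d := d) (N * L ^ (j + 1))))
      ≤ 1806 * k₂ * energyNormW L (j + 1) (cavg L UB) (fun y μ => Nn y μ - X₀ y μ) (periodBox (d := d) (N * L ^ (j + 1))) ^ 2 := by
    have hpt : ∀ y μ, ‖(normalPart X₀ fun y μ => Nn y μ - X₀ y μ) y μ‖ ≤ (1 + 2048 * (α₀ + αN)) * ‖Nn y μ‖ := by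
      intro y μ
      have h1 := hNgsub y μ
      calc ‖(normalPart X₀ fun y μ => Nn y μ - X₀ y μ) y μ‖
          = ‖((normalPart X₀ fun y μ => Nn y μ - X₀ y μ) y μ - Nn y μ) + Nn y μ‖ := by rw [sub_add_cancel]
        _ ≤ ‖(normalPart X₀ fun y μ => Nn y μ - X₀ y μ) y μ - Nn y μ‖ + ‖Nn y μ‖ := norm_add_le _ _
        _ ≤ 2048 * (α₀ + αN) * ‖Nn y μ‖ + ‖Nn y μ‖ := add_le_add h1 le_rfl
        _ = (1 + 2048 * (α₀ + αN)) * ‖Nn y μ‖ := by ring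
    have h2 : dirL1 (normalPart X₀ fun y μ => Nn y μ - X₀ y μ) (periodBox (d := d) (N * L ^ (j + 1)))
        ≤ (1 + 2048 * (α₀ + αN)) * dirL1 Nn (periodBox (d := d) (N * L ^ (j + 1))) := dirL1_le_of_pointwise hpt _
    -- `(s + (1+2048 s)αN) ≤ 43·s` and `(1 + 2048 s) ≤ 42`, so the factor is `≤ 43·42·(s·dirL1 Nn) = 1806·(s·dirL1 Nn)`
    have hf1 : (α₀ + αN) + (1 + 2048 * (α₀ + αN)) * αN ≤ 43 * (α₀ + αN) := by nlinarith
    have hfac0 : 0 ≤ (α₀ + αN) + (1 + 2048 * (α₀ + αN)) * αN := by positivity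
    have h5 : ((α₀ + αN) + (1 + 2048 * (α₀ + αN)) * αN) * dirL1 (normalPart X₀ fun y μ => Nn y μ - X₀ y μ)
          (periodBox (d := d) (N * L ^ (j + 1)))
        ≤ (43 * (α₀ + αN)) * ((1 + 2048 * (α₀ + αN)) * dirL1 Nn (periodBox (d := d) (N * L ^ (j + 1)))) :=
      mul_le_mul hf1 h2 (dirL1_nonneg _ _) (by positivity)
    have h6 : (43 * (α₀ + αN)) * ((1 + 2048 * (α₀ + αN)) * dirL1 Nn (periodBox (d := d) (N * L ^ (j + 1))))
        ≤ (43 * (α₀ + αN)) * (42 * dirL1 Nn (periodBox (d := d) (N * L ^ (j + 1)))) :=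
      mul_le_mul_of_nonneg_left (mul_le_mul_of_nonneg_right h42 hdl0) (by positivity)
    have h7 : a * (((α₀ + αN) + (1 + 2048 * (α₀ + αN)) * αN)
          * dirL1 (normalPart X₀ fun y μ => Nn y μ - X₀ y μ) (periodBox (d := d) (N * L ^ (j + 1))))
        ≤ a * ((43 * (α₀ + αN)) * (42 * dirL1 Nn (periodBox (d := d) (N * L ^ (j + 1))))) :=
      mul_le_mul_of_nonneg_left (h5.trans h6) ha
    have h8 : a * ((43 * (α₀ + αN)) * (42 * dirL1 Nn (periodBox (d := d) (N * L ^ (j + 1)))))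
        = 1806 * (a * ((α₀ + αN) * dirL1 Nn (periodBox (d := d) (N * L ^ (j + 1))))) := by ring
    have h9 := mul_le_mul_of_nonneg_left hl1 (by norm_num : (0:ℝ) ≤ 1806)
    linarith
  -- assemble
  exact
    { gauge := hgauge
      rep := hrep
      skewX := hXs
      perX := hXP
      skewN := hNgs
      perN := hNgP
      tangent := htan
      perT := fun _ hY => periodic_of_mem_slicB8 hY
      supX := hXsup
      supN := hNgsup
      hα0 := hs0
      hαN0 := by positivity
      hα := by linarith
      hαN := by linarith
      hαk := by
        have h1 : (α₀ + αN) + (1 + 2048 * (α₀ + αN)) * αN ≤ α₀ + 43 * αN := by linarith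
        exact (mul_le_mul_of_nonneg_right h1 (by positivity : (0:ℝ) ≤ (L : ℝ) ^ (j + 1))).trans hJ1
      admW := admW
      ha := ha
      small := hsmall
      nwN := hnwN
      curlN := hcurlN
      l1N := hl1N }



end

end Summit.QuantumFields.BalabanUV.T4Continuum.NE3.DecomposedRepTSlicB8
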